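import Summits.NavierStokesRegularity.FluidComputer.PalasekTowerBurgersLayerReadout
import Summits.NavierStokesRegularity.FluidComputer.PalasekTowerBurgersLayerCircle

/-!
# The level-1 READ-OUT of the wide register as a Burgers vortex LAYER, II: the card's first lemma
# `LayerReadoutWide` and its companion `SheetBandUniform`, PROVED

Cell `ns-blowup`, seat `ns-blowup-ecbridge-4` (g6; D-0074 GROUP C «BRIDGE SUPPORT», stub `first_episode` of
the crux `EpisodeBase` = item stmt-NavierStokesRegularity-19179 of the route `PalasekTowerBreakdown`, line
`slot`; supports / evidence only, nothing claimed). Objects and statements: the companion file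
`PalasekTowerBurgersLayerReadout.lean` (verbatim from the card «orthogonal-seed-contact-strain», 19179
evidence #47/#48); calculus on the layer: `PalasekTowerBurgersLayerBounds.lean`; the circle loop and the
generic circulation floor `circulation ≥ π(ΔU/√π)κρ²(1 − κ²ρ²/3)`: `PalasekTowerBurgersLayerCircle.lean`; certified brackets
`445 < N₁ < 446`, `2778 < Y₁ < 2779`, `1238360 < A₁ < 1238361`, `6.233 < N₁^{β−2} < 6.234`:
`PalasekTowerHeredityWitnessCalibration.lean`. Proved here (real analysis only):

* `layerReadoutWide : LayerReadoutWide` — velocity floor `Y₁ ≤ ‖u(1/120, 0, 0)‖` (indeed `≥ 3040`: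
  `‖u‖² = (6500/3)² + V(1/120)²`, `V(1/120) ≥ (2/3)·6400/√π ≥ 6400/3` as `κ/120 ≥ 1`); strain floor
  `A₁ ≤ ‖Du(0)‖` (`≥ V′(0) = 6400·√130000/√π ≥ (6400/1.775)·360.5 ≥ 1299831`); ceiling `(5/3)Y₁` on the
  slab `x₀² + x₂² ≤ (1/80)²` (`‖u‖² ≤ 260000²/6400 + 3200² = 20802500 ≤ 4630²`); core ledger
  `N₁^{β−2} ≤ circulation` on the circle of radius `ρ = 1/N₁` (integrand `2πγρ² sin cos + 2π(ρ cos)·V(ρ cos)`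
  at `2πs`; with `t·V(t) ≥ (ΔU/√π)(κt² − κ³t⁴/3)`, `cos⁴ ≤ cos²`, `∫₀¹ sin cos = 0`, `∫₀¹ cos² = 1/2`:
  circulation `≥ π(ΔU/√π)κρ²(1 − κ²ρ²/3) ≥ 3·3200·360.5·(1/446)²·0.78 ≥ 13.5 > 6.234`);
* `sheetBandUniform : SheetBandUniform` — for EVERY `k`: `V′(0) = (12/5)(3/(5π))^{1/2}·Y_{k+1}N_{k+1} ≥
  A_{k+1}` since `Y_{k+1}N_{k+1} = A_{k+1}` and `(144/25)(3/5) = 3.456 ≥ π`;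
* §3: the four facts in the exact shape of the register's clauses — `Stage.floor`, `Margins.withStrain`,
  `Stage.ceiling` (on the slab), and the `j = 1` clause of `CoreLedger` (admissible loop, circulation
  `≥ c₁N₁^{β−2}`) — with the slice `u (τ 1)` replaced by the profile.

LABEL: MODEL-side register arithmetic on an exact, steady, infinite-energy profile. WHAT THIS IS NOT: not
Navier–Stokes evidence — nothing about any registered stage, the card's HOST (dipole collision, contact
strain), `FirstEpisodeD`, `RungG 1`, `EpisodeBaseG` or blow-up; the register's ceiling is global in `x` and
is met here only on the slab where the layer is the local model. [cite: Palasek2026ElementaryModel, §4]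
-/

noncomputable section
namespace Summit.NavierStokesRegularity.FluidComputer.PalasekTowerClayBridge

open Set MeasureTheory Filter Topology Function Real intervalIntegral
open scoped ContDiff
open Literature.Analysis.FluidPDE

namespace OrthogonalSeed

/-! ## §1 `LayerReadoutWide` -/

/-! ### Velocity floor, strain floor, slab ceiling -/

/-- **Velocity floor**: `Y₁ ≤ ‖u(1/120, 0, 0)‖` — `‖u‖² = (260000/120)² + V(1/120)²` with
`V(1/120) ≥ (2/3)·6400/√π ≥ 6400/3` (as `κ/120 ≥ 1`), so `‖u‖ ≥ 3040 > 2779 > Y₁`. [folklore] -/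
theorem speedFloor : TowerRates.wide.Y 1 ≤ ‖readout !₂[(1 : ℝ) / 120, 0, 0]‖ := by
  have hY := TowerRates.wide_Y_one_bounds.2
  obtain ⟨hκ, -⟩ := rate_bounds
  have hs : 1 ≤ burgersLayerRate γc 1 * (1 / 120) := by
    have : (1 : ℝ) ≤ 360.5 * (1 / 120) := by norm_num
    exact this.trans (mul_le_mul_of_nonneg_right hκ (by norm_num))
  have hV : ΔUc / Real.sqrt Real.pi * (2 / 3) ≤ burgersLayerProfile γc 1 ΔUc (1 / 120) :=
    burgersLayerProfile_ge_of_one_le (by norm_num [ΔUc]) hs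
  have hV' : (6400 : ℝ) / 3 ≤ burgersLayerProfile γc 1 ΔUc (1 / 120) := by
    refine le_trans ?_ hV
    have hπ : 0 < Real.sqrt Real.pi := Real.sqrt_pos.2 Real.pi_pos
    rw [ΔUc, div_mul_eq_mul_div, le_div_iff₀ hπ]
    nlinarith [sqrt_pi_le_two]
  have hsq : ‖readout !₂[(1 : ℝ) / 120, 0, 0]‖ ^ 2 =
      γc ^ 2 * ((1 / 120) ^ 2 + 0 ^ 2) + burgersLayerProfile γc 1 ΔUc (1 / 120) ^ 2 := by
    rw [readout, norm_burgersLayer_sq]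
    simp
  have hγ : γc ^ 2 * (((1 : ℝ) / 120) ^ 2 + 0 ^ 2) = 42250000 / 9 := by norm_num [γc]
  have h3 : (2779 : ℝ) ^ 2 ≤ ‖readout !₂[(1 : ℝ) / 120, 0, 0]‖ ^ 2 := by
    rw [hsq, hγ]
    nlinarith [hV', sq_nonneg (burgersLayerProfile γc 1 ΔUc (1 / 120) - 6400 / 3)]
  have h4 : (2779 : ℝ) ≤ ‖readout !₂[(1 : ℝ) / 120, 0, 0]‖ := by
    nlinarith [norm_nonneg (readout !₂[(1 : ℝ) / 120, 0, 0]), h3]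
  linarith

/-- **Strain floor**: `A₁ ≤ ‖Du(0)‖` — `‖Du(0)‖ ≥ V′(0) = 6400·√130000/√π ≥ (6400/1.775)·360.5
≥ 1299831 > 1238361 > A₁`. [folklore] -/
theorem strainFloor : TowerRates.wide.A 1 ≤ ‖fderiv ℝ readout 0‖ := by
  have hA := TowerRates.wide_A_one_bounds.2
  obtain ⟨hκ, -⟩ := rate_bounds
  have h := slope_le_norm_fderiv_burgersLayer (γ := γc) (ν := 1) (ΔU := ΔUc)
    (x := (0 : EuclideanSpace ℝ (Fin 3))) rfl
  have hπ : 0 < Real.sqrt Real.pi := Real.sqrt_pos.2 Real.pi_pos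
  have h1 : (6400 : ℝ) / 1.775 ≤ ΔUc / Real.sqrt Real.pi := by
    rw [ΔUc]
    exact div_le_div_of_nonneg_left (by norm_num) hπ sqrt_pi_le
  have h2 : (6400 : ℝ) / 1.775 * 360.5 ≤ ΔUc / Real.sqrt Real.pi * burgersLayerRate γc 1 :=
    mul_le_mul h1 hκ (by norm_num) (le_trans (by norm_num) h1)
  have h3 : (1238361 : ℝ) ≤ 6400 / 1.775 * 360.5 := by norm_num
  rw [readout]
  linarith

/-- **Slab ceiling**: `‖u(x)‖ ≤ (5/3)·Y₁` whenever `x₀² + x₂² ≤ (1/80)²` —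
`‖u‖² = γ²(x₀² + x₂²) + V² ≤ 260000²/6400 + 3200² = 20802500 ≤ 4630² ≤ ((5/3)Y₁)²`. [folklore] -/
theorem slabCeiling (x : EuclideanSpace ℝ (Fin 3)) (hx : x 0 ^ 2 + x 2 ^ 2 ≤ (1 / 80) ^ 2) :
    ‖readout x‖ ≤ 5 / 3 * TowerRates.wide.Y 1 := by
  have hY := TowerRates.wide_Y_one_bounds.1
  have hV := burgersLayerProfile_sq_le (γ := γc) (ν := 1) (ΔU := ΔUc)
    (by norm_num [γc]) one_pos (by norm_num [ΔUc]) (x 0)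
  have hc : (ΔUc / 2) ^ 2 = (3200 : ℝ) ^ 2 := by norm_num [ΔUc]
  rw [hc] at hV
  have hγ : γc ^ 2 = (260000 : ℝ) ^ 2 := by norm_num [γc]
  have hsq := norm_burgersLayer_sq γc 1 ΔUc x
  rw [hγ] at hsq
  have h1 : ‖readout x‖ ^ 2 ≤ 4630 ^ 2 := by
    rw [readout, hsq]
    nlinarith [hx, hV]
  have h2 : ‖readout x‖ ≤ 4630 := by
    nlinarith [norm_nonneg (readout x), h1]
  linarith

/-! ### The circulation -/

/-- **Core-ledger floor, quantitative**: the circulation of the layer around the loop is at least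
`π (ΔU/√π) κ ρ² (1 − κ²ρ²/3)`, `ρ = 1/N₁` — the instance `(γ, ν, ΔU, ρ) = (γ_c, 1, ΔU_c, 1/N₁)` of
`circulation_circle_ge` (`PalasekTowerBurgersLayerCircle.lean`). [folklore] -/
theorem circulation_ge :
    π * (ΔUc / Real.sqrt Real.pi * (burgersLayerRate γc 1 * (1 / TowerRates.wide.N 1) ^ 2 *
        (1 - burgersLayerRate γc 1 ^ 2 * (1 / TowerRates.wide.N 1) ^ 2 / 3))) ≤
      circulation readout coreLoop :=
  circulation_circle_ge (γ := γc) (ν := 1) (ΔU := ΔUc) (by norm_num [γc]) one_pos (by norm_num [ΔUc])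
    (1 / TowerRates.wide.N 1)

/-- **Core-ledger floor**: `N₁^{β−2} ≤ circulation`, since the quantitative bound is at least
`3 · 3200 · 360.5 · (1/446)² · 0.78 ≥ 13.5 > 6.234 > N₁^{β−2}`. [folklore] -/
theorem coreFloor : TowerRates.wide.N 1 ^ (TowerRates.wide.β - 2) ≤ circulation readout coreLoop := by
  refine le_trans ?_ circulation_ge
  have hN := TowerRates.wide_N_one_rpow_bounds.2
  obtain ⟨hκ1, hκ2⟩ := rate_bounds
  obtain ⟨hρ1, hρ2⟩ := inv_N_one_bounds
  set ρ : ℝ := 1 / TowerRates.wide.N 1 with hρ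
  set κ := burgersLayerRate γc 1 with hκ
  have hπs : 0 < Real.sqrt Real.pi := Real.sqrt_pos.2 Real.pi_pos
  have hD : (3200 : ℝ) ≤ ΔUc / Real.sqrt Real.pi := by
    rw [ΔUc, le_div_iff₀ hπs]; nlinarith [sqrt_pi_le_two]
  have hρ0 : 0 ≤ ρ := le_trans (by norm_num) hρ1
  have hκρ : κ ^ 2 * ρ ^ 2 ≤ 361 ^ 2 * (1 / 445) ^ 2 := by
    have h1 : κ ^ 2 ≤ 361 ^ 2 := pow_le_pow_left₀ (by linarith) hκ2 2
    have h2 : ρ ^ 2 ≤ (1 / 445) ^ 2 := pow_le_pow_left₀ hρ0 hρ2 2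
    exact mul_le_mul h1 h2 (by positivity) (by positivity)
  have hfac : (0.78 : ℝ) ≤ 1 - κ ^ 2 * ρ ^ 2 / 3 := by
    have : (361 : ℝ) ^ 2 * (1 / 445) ^ 2 / 3 ≤ 0.22 := by norm_num
    linarith
  have hρsq : (1 / 446 : ℝ) ^ 2 ≤ ρ ^ 2 := pow_le_pow_left₀ (by norm_num) hρ1 2
  have hA : (360.5 : ℝ) * (1 / 446) ^ 2 * 0.78 ≤ κ * ρ ^ 2 * (1 - κ ^ 2 * ρ ^ 2 / 3) :=
    mul_le_mul (mul_le_mul hκ1 hρsq (by positivity) (by linarith)) hfac (by norm_num)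
      (by positivity)
  have hB : (3200 : ℝ) * (360.5 * (1 / 446) ^ 2 * 0.78) ≤
      ΔUc / Real.sqrt Real.pi * (κ * ρ ^ 2 * (1 - κ ^ 2 * ρ ^ 2 / 3)) :=
    mul_le_mul hD hA (by positivity) (by linarith)
  have hC : (3 : ℝ) * (3200 * (360.5 * (1 / 446) ^ 2 * 0.78)) ≤
      π * (ΔUc / Real.sqrt Real.pi * (κ * ρ ^ 2 * (1 - κ ^ 2 * ρ ^ 2 / 3))) :=
    mul_le_mul Real.pi_gt_three.le hB (by positivity) Real.pi_pos.le
  have hnum : (6.234 : ℝ) ≤ 3 * (3200 * (360.5 * (1 / 446) ^ 2 * 0.78)) := by norm_num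
  linarith

/-- **The card's first lemma holds.** [folklore] -/
theorem layerReadoutWide : LayerReadoutWide :=
  ⟨speedFloor, strainFloor, slabCeiling, coreFloor⟩

/-! ## §2 `SheetBandUniform` -/

/-- The rate of the sheet-band layer: `κ = ((6/5)N²/2)^{1/2} = (3/5)^{1/2}·N` for `N ≥ 0`. [folklore] -/
theorem burgersLayerRate_sheet {N : ℝ} (hN : 0 ≤ N) :
    burgersLayerRate (6 / 5 * N ^ 2) 1 = Real.sqrt (3 / 5) * N := by
  unfold burgersLayerRate
  rw [show (6 : ℝ) / 5 * N ^ 2 / (2 * 1) = 3 / 5 * N ^ 2 by ring,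
    Real.sqrt_mul (by norm_num), Real.sqrt_sq hN]

/-- `√π ≤ (12/5)·√(3/5)`, i.e. `π ≤ 432/125 = 3.456`. [folklore] -/
theorem sqrt_pi_le_sheet : Real.sqrt Real.pi ≤ 12 / 5 * Real.sqrt (3 / 5) := by
  have h1 : Real.sqrt Real.pi ≤ Real.sqrt (432 / 125) :=
    Real.sqrt_le_sqrt (by linarith [Real.pi_lt_d2])
  have h2 : Real.sqrt (432 / 125 : ℝ) = 12 / 5 * Real.sqrt (3 / 5) := by
    rw [show (432 : ℝ) / 125 = (12 / 5) ^ 2 * (3 / 5) by norm_num, Real.sqrt_mul (by norm_num),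
      Real.sqrt_sq (by norm_num)]
  rw [← h2]; exact h1

/-- `Y_k · N_k = A_k` on any rates (`N^{β−1} · N = N^β`). [folklore] -/
theorem Y_mul_N (R : TowerRates) (k : ℕ) : R.Y k * R.N k = R.A k := by
  have hN : 0 < R.N k := R.N_pos k
  simp only [TowerRates.Y, TowerRates.A]
  rw [Real.rpow_sub_one hN.ne']
  field_simp

/-- **The card's `SheetBandUniform` holds**: for every `k`, `A_{k+1} ≤ ‖Du(0)‖` for the layer with
`ΔU = (12/5)Y_{k+1}`, `γ = (6/5)N_{k+1}²`, `ν = 1`. [folklore] -/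
theorem sheetBandUniform : SheetBandUniform := by
  intro k
  set N := TowerRates.wide.N (k + 1) with hN
  set Y := TowerRates.wide.Y (k + 1) with hY
  have hN0 : 0 < N := TowerRates.wide.N_pos (k + 1)
  have hY0 : 0 < Y := Real.rpow_pos_of_pos hN0 _
  have h := slope_le_norm_fderiv_burgersLayer (γ := 6 / 5 * N ^ 2) (ν := 1) (ΔU := 12 / 5 * Y)
    (x := (0 : EuclideanSpace ℝ (Fin 3))) rfl
  rw [burgersLayerRate_sheet hN0.le] at h
  refine le_trans ?_ h
  have hπs : 0 < Real.sqrt Real.pi := Real.sqrt_pos.2 Real.pi_pos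
  have hA : TowerRates.wide.A (k + 1) = Y * N := (Y_mul_N TowerRates.wide (k + 1)).symm
  rw [hA, show (12 : ℝ) / 5 * Y / Real.sqrt Real.pi * (Real.sqrt (3 / 5) * N) =
      (12 / 5 * Real.sqrt (3 / 5) / Real.sqrt Real.pi) * (Y * N) by ring]
  have hc : (1 : ℝ) ≤ 12 / 5 * Real.sqrt (3 / 5) / Real.sqrt Real.pi := by
    rw [le_div_iff₀ hπs, one_mul]; exact sqrt_pi_le_sheet
  have hYN : 0 ≤ Y * N := by positivity
  nlinarith

/-! ## §3 The four facts in the shape of the register's clauses -/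

/-- **Floor clause** (`Stage.floor` at `j = 1`, slice replaced by the profile): on a rigid schedule whose
ball has radius `≥ 1/120` the layer shows the level-1 speed floor `c₁ Y₁` in the ball. [folklore] -/
theorem floor_clause (S : Schedule TowerRates.wide) (hS : S.Rigid) (hρ : 1 / 120 ≤ S.radius) :
    ∃ x : EuclideanSpace ℝ (Fin 3), ‖x‖ ≤ S.radius ∧ S.c₁ * TowerRates.wide.Y 1 ≤ ‖readout x‖ := by
  refine ⟨!₂[(1 : ℝ) / 120, 0, 0], ?_, by rw [hS.c₁_eq, one_mul]; exact speedFloor⟩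
  have hsq := norm_vec_sq ((1 : ℝ) / 120) 0 0
  have h : ‖(!₂[(1 : ℝ) / 120, 0, 0] : EuclideanSpace ℝ (Fin 3))‖ = 1 / 120 :=
    (sq_eq_sq₀ (norm_nonneg _) (by norm_num)).1 (by rw [hsq]; ring)
  rw [h]; exact hρ

/-- **Strain clause** (`Margins.withStrain` at `j = 1`, slice replaced by the profile): the layer shows the
level-1 gradient floor `c₁ A₁` at the centre of any ball of nonnegative radius. [folklore] -/
theorem strain_clause (S : Schedule TowerRates.wide) (hS : S.Rigid) (hρ : 0 ≤ S.radius) :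
    ∃ x : EuclideanSpace ℝ (Fin 3), ‖x‖ ≤ S.radius ∧
      S.c₁ * TowerRates.wide.A 1 ≤ ‖fderiv ℝ readout x‖ :=
  ⟨0, by rwa [norm_zero], by rw [hS.c₁_eq, one_mul]; exact strainFloor⟩

/-- **Ceiling clause on the slab** (`Stage.ceiling` at `j = 1` restricted to the slab
`x₀² + x₂² ≤ (1/80)²`, slice replaced by the profile). [folklore] -/
theorem ceiling_clause (S : Schedule TowerRates.wide) (hS : S.Rigid) (x : EuclideanSpace ℝ (Fin 3))
    (hx : x 0 ^ 2 + x 2 ^ 2 ≤ (1 / 80) ^ 2) : ‖readout x‖ ≤ S.c₂ * TowerRates.wide.Y 1 := by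
  rw [hS.c₂_eq]; exact slabCeiling x hx

/-- **Core-ledger clause** (the `j = 1` clause of `CoreLedger TowerRates.wide S 1 u` with the slice
`u (τ 1)` replaced by the profile): an admissible loop — `C¹`, closed, inside the closed ball of radius
`1/N₁` centred in the tower's ball, of speed `≤ 8π/N₁` — carries circulation `≥ c₁ N₁^{β−2}`
(`coreLedger_clause_of_circle` applied to `coreFloor`). [folklore] -/
theorem coreLedger_clause (S : Schedule TowerRates.wide) (hS : S.Rigid) (hρ : 0 ≤ S.radius) :
    ∃ (x : EuclideanSpace ℝ (Fin 3)) (γ : ℝ → EuclideanSpace ℝ (Fin 3)),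
      ‖x‖ ≤ S.radius ∧ ContDiff ℝ 1 γ ∧ γ 0 = γ 1 ∧
      (∀ s ∈ Icc (0 : ℝ) 1, γ s ∈ Metric.closedBall x (1 / TowerRates.wide.N 1)) ∧
      (∀ s ∈ Icc (0 : ℝ) 1, ‖deriv γ s‖ ≤ 8 * π / TowerRates.wide.N 1) ∧
      S.c₁ * TowerRates.wide.N 1 ^ (TowerRates.wide.β - 2) ≤ circulation readout γ :=
  coreLedger_clause_of_circle S hS hρ readout 1 coreFloor

end OrthogonalSeed

end Summit.NavierStokesRegularity.FluidComputer.PalasekTowerClayBridge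

end
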